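import Literature.Topology.FourManifolds.MonotoneInverse
import Mathlib.Algebra.Order.ToIntervalMod
import Mathlib.Topology.MetricSpace.Basic
import HarnessLib

/-!
# The extreme arc of a closed curve in the chart: window, inverse, separation constants

Topic `Literature/Topology/FourManifolds`; a brick of the realisation of connected sums of knot
diagrams (`ConnSumBand`, `ConnSumRealisation`, serving the unconditional existential additivity of
Rasmussen's `s` and the named fact `HasRasmussenInvariant.eq_of_isConcordant` of `Rasmussen.lean`).
Pure one-variable analysis of a `C^∞`, `2π`-periodic curve `c : ℝ → (ℝ × ℝ) × ℝ` — a knot read in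
the stereographic chart `((a, y), h)` of `GaussDiagrams.lean` — near a parameter `θ₀` at which the
first planar coordinate `a` attains its **maximum** (normalised to `a = -1`, `y = 0` at `θ₀`),
where the plane curve moves in the direction of increasing `y` and has no crossing passage nearby
(`ConnSum.ArcData`). This is the arc along which the band of a connected sum is attached to the
left summand (for the right summand one uses the point-reflected curve `-c`). We derive:

* a **window** `[θ₀ - w, θ₀ + w]` on which `y` is strictly increasing with positive derivative
  (`ArcData.w`, `strictMonoOn_y`), its **inverse** `τ = y⁻¹` (`ArcData.τ`, through the tree's
  `MonoInverse`, `MonotoneInverse.lean`), the **arc parametrised by `y`**, `α s = c (τ s)`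
  (`ArcData.α`, with `(α s).1.2 = s`, `α 0 = c θ₀`, smooth with the chain rule on the open image),
  and the graph description `c θ = α (y θ)` on the window;
* a **radius** `ζ > 0` with `[-2ζ, 2ζ]` inside the image of the window;
* **separation constants**: `sep > 0`, a lower bound for the distance in space between the far
  part of the curve (parameters `[θ₀ + w, θ₀ - w + 2π]`) and the arc `α [-ζ, ζ]`, and `μ > 0`, the
  same for the plane curves; hence the recognition lemmas `eq_α_of_dist_lt` (a point of the curve
  at distance `< sep` from `α s` with second planar coordinate `s` *is* `α s`) and
  `fst_eq_of_dist_lt` (planar version);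
* continuity consequences at `s = 0` used to size the band (`exists_abs_g_add_one_lt`).

Everything here is proved; no named facts are introduced.

## References

* R. H. Crowell, R. H. Fox, *Introduction to Knot Theory* (1963), Ch. I §2. [CrowellFox1963]
* P. R. Cromwell, *Knots and Links* (2004), §4.6 (the rectangle of a product of knots).
  [Cromwell2004]

## Design notes

`ArcData` is a `Type`-valued structure carrying the curve and the chosen parameter; the derived
constants are `def`s by `Classical.choose` with their specifications as theorems, as in
`KnotFlatArc.lean`. No statement of another file is modified; no `sorry`; no definitions of `Prop`
type.
-/

open scoped ContDiff Topology Real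
open Function Set Filter Metric

noncomputable section

namespace Literature.Topology.FourManifolds

namespace ConnSum

/-- The second planar coordinate as a continuous linear map `((a, y), h) ↦ y`. [folklore] -/
def yL : ((ℝ × ℝ) × ℝ) →L[ℝ] ℝ :=
  (ContinuousLinearMap.snd ℝ ℝ ℝ).comp (ContinuousLinearMap.fst ℝ (ℝ × ℝ) ℝ)

/-- `yL` reads the second planar coordinate. [folklore] -/
@[simp] theorem yL_apply (p : (ℝ × ℝ) × ℝ) : yL p = p.1.2 := rfl

/-- The planar part as a continuous linear map `((a, y), h) ↦ (a, y)`. [folklore] -/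
def plL : ((ℝ × ℝ) × ℝ) →L[ℝ] (ℝ × ℝ) :=
  ContinuousLinearMap.fst ℝ (ℝ × ℝ) ℝ

/-- `plL` reads the planar part. [folklore] -/
@[simp] theorem plL_apply (p : (ℝ × ℝ) × ℝ) : plL p = p.1 := rfl

/-- **Extreme-arc data**: a `C^∞`, `2π`-periodic curve `c` in the chart `((a, y), h)`, injective
modulo the period, whose first planar coordinate is everywhere `≤ -1` and equals `-1` at the
parameter `θ₀`, where the second planar coordinate vanishes and has positive derivative, and such
that no other parameter has the same plane point as a parameter within `w₀` of `θ₀` (no crossing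
passage near `θ₀`). Cromwell (2004), §4.6. [folklore] -/
structure ArcData where
  /-- The curve in the chart. -/
  c : ℝ → (ℝ × ℝ) × ℝ
  /-- The curve is `C^∞`. -/
  contDiff : ContDiff ℝ ∞ c
  /-- The curve is `2π`-periodic. -/
  periodic : Periodic c (2 * π)
  /-- The curve identifies exactly the period translates. -/
  eq_imp : ∀ s t, c s = c t → ∃ k : ℤ, t = s + k * (2 * π)
  /-- The attaching parameter. -/
  θ₀ : ℝ
  /-- The first planar coordinate is at most `-1` … -/
  fst_le : ∀ θ, (c θ).1.1 ≤ -1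
  /-- … with equality at `θ₀`, where the second planar coordinate vanishes. -/
  c_θ₀_fst : (c θ₀).1 = (-1, 0)
  /-- The plane curve moves upwards at `θ₀`. -/
  deriv_y_pos : 0 < deriv (fun θ ↦ (c θ).1.2) θ₀
  /-- The half-width of a parameter window about `θ₀` free of crossing passages. -/
  w₀ : ℝ
  /-- The window is nondegenerate. -/
  w₀_pos : 0 < w₀
  /-- No crossing passage near `θ₀`: a parameter with the same plane point as a parameter within
  `w₀` of `θ₀` (modulo `2π`) is a period translate of it. -/
  planar_eq_imp : ∀ s t, (c s).1 = (c t).1 → s ∈ Icc (θ₀ - w₀) (θ₀ + w₀) → ∃ k : ℤ, t = s + k * (2 * π)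

namespace ArcData

variable (D : ArcData)

/-! ### Coordinates -/

/-- The first planar coordinate `a` along the curve. [folklore] -/
def a (θ : ℝ) : ℝ := (D.c θ).1.1

/-- The second planar coordinate `y` along the curve. [folklore] -/
def y (θ : ℝ) : ℝ := (D.c θ).1.2

/-- `y` is `yL ∘ c`. [folklore] -/
theorem y_eq_comp : D.y = yL ∘ D.c := rfl

/-- `y` is `C^∞`. [folklore] -/
theorem contDiff_y : ContDiff ℝ ∞ D.y := by
  rw [y_eq_comp]; exact yL.contDiff.comp D.contDiff

/-- `y` is continuous. [folklore] -/
theorem continuous_y : Continuous D.y := D.contDiff_y.continuous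

/-- The curve is continuous. [folklore] -/
theorem continuous_c : Continuous D.c := D.contDiff.continuous

/-- The curve is differentiable. [folklore] -/
theorem differentiable_c : Differentiable ℝ D.c := D.contDiff.differentiable (by simp)

/-- The derivative of `y` is the `y`-component of the velocity. [folklore] -/
theorem deriv_y (θ : ℝ) : deriv D.y θ = (deriv D.c θ).1.2 := by
  rw [y_eq_comp]
  exact (yL.hasFDerivAt.comp_hasDerivAt θ (D.differentiable_c θ).hasDerivAt).deriv

/-- The derivative of `y` is continuous. [folklore] -/
theorem continuous_deriv_y : Continuous (deriv D.y) :=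
  D.contDiff_y.continuous_deriv (by simp)

/-- `a ≤ -1` everywhere. [folklore] -/
theorem a_le (θ : ℝ) : D.a θ ≤ -1 := D.fst_le θ

/-- `a θ₀ = -1`. [folklore] -/
theorem a_θ₀ : D.a D.θ₀ = -1 := by
  have := D.c_θ₀_fst; unfold a; rw [this]

/-- `y θ₀ = 0`. [folklore] -/
theorem y_θ₀ : D.y D.θ₀ = 0 := by
  have := D.c_θ₀_fst; unfold y; rw [this]

/-- `y' (θ₀) > 0`. [folklore] -/
theorem deriv_y_θ₀_pos : 0 < deriv D.y D.θ₀ := D.deriv_y_pos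

/-- `y` is `2π`-periodic. [folklore] -/
theorem periodic_y : Periodic D.y (2 * π) := fun θ ↦ by
  unfold y; rw [D.periodic θ]

/-! ### The window -/

/-- **A window about `θ₀` on which `y' > 0`**, shorter than the crossing-free window and than a
half period. [folklore] -/
theorem exists_window : ∃ w : ℝ, 0 < w ∧ w ≤ D.w₀ ∧ w < π / 2 ∧
    ∀ θ ∈ Icc (D.θ₀ - w) (D.θ₀ + w), 0 < deriv D.y θ := by
  have hc : ContinuousAt (deriv D.y) D.θ₀ := D.continuous_deriv_y.continuousAt
  have hev : ∀ᶠ θ in 𝓝 D.θ₀, 0 < deriv D.y θ := hc.eventually (lt_mem_nhds D.deriv_y_θ₀_pos)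
  obtain ⟨ε, hε, hball⟩ := Metric.eventually_nhds_iff.1 hev
  refine ⟨min (ε / 2) (min D.w₀ (π / 4)), ?_, ?_, ?_, fun θ hθ ↦ hball ?_⟩
  · exact lt_min (by linarith) (lt_min D.w₀_pos (by positivity))
  · exact (min_le_right _ _).trans (min_le_left _ _)
  · have : π / 4 < π / 2 := by linarith [Real.pi_pos]
    exact (min_le_right _ _).trans_lt ((min_le_right _ _).trans_lt this)
  · rw [Real.dist_eq, abs_lt]
    have h1 : min (ε / 2) (min D.w₀ (π / 4)) ≤ ε / 2 := min_le_left _ _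
    constructor <;> linarith [hθ.1, hθ.2]

/-- The half-width `w` of the window. [folklore] -/
def w : ℝ := Classical.choose D.exists_window

/-- The specification of `w`. [folklore] -/
theorem w_spec : 0 < D.w ∧ D.w ≤ D.w₀ ∧ D.w < π / 2 ∧
    ∀ θ ∈ Icc (D.θ₀ - D.w) (D.θ₀ + D.w), 0 < deriv D.y θ :=
  Classical.choose_spec D.exists_window

/-- `w > 0`. [folklore] -/
theorem w_pos : 0 < D.w := D.w_spec.1

/-- `w ≤ w₀`. [folklore] -/
theorem w_le_w₀ : D.w ≤ D.w₀ := D.w_spec.2.1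

/-- `w < π / 2`. [folklore] -/
theorem w_lt : D.w < π / 2 := D.w_spec.2.2.1

/-- `y' > 0` on the window. [folklore] -/
theorem deriv_y_pos_of_mem {θ : ℝ} (hθ : θ ∈ Icc (D.θ₀ - D.w) (D.θ₀ + D.w)) : 0 < deriv D.y θ :=
  D.w_spec.2.2.2 θ hθ

/-- The window is nondegenerate. [folklore] -/
theorem lo_lt_hi : D.θ₀ - D.w < D.θ₀ + D.w := by linarith [D.w_pos]

/-- **`y` is strictly increasing on the window.** [folklore] -/
theorem strictMonoOn_y : StrictMonoOn D.y (Icc (D.θ₀ - D.w) (D.θ₀ + D.w)) :=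
  strictMonoOn_of_deriv_pos (convex_Icc _ _) D.continuous_y.continuousOn fun _ hθ ↦
    D.deriv_y_pos_of_mem (interior_subset hθ)

/-! ### The inverse of `y` on the window and the arc parametrised by `y` -/

/-- The lower end `y (θ₀ - w)` of the image of the window. [folklore] -/
def ylo : ℝ := D.y (D.θ₀ - D.w)

/-- The upper end `y (θ₀ + w)` of the image of the window. [folklore] -/
def yhi : ℝ := D.y (D.θ₀ + D.w)

/-- `ylo < 0`. [folklore] -/
theorem ylo_neg : D.ylo < 0 := by
  rw [← D.y_θ₀]
  exact D.strictMonoOn_y ⟨le_rfl, by linarith [D.w_pos]⟩ ⟨by linarith [D.w_pos], by linarith [D.w_pos]⟩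
    (by linarith [D.w_pos])

/-- `0 < yhi`. [folklore] -/
theorem yhi_pos : 0 < D.yhi := by
  rw [← D.y_θ₀]
  exact D.strictMonoOn_y ⟨by linarith [D.w_pos], by linarith [D.w_pos]⟩ ⟨by linarith [D.w_pos], le_rfl⟩
    (by linarith [D.w_pos])

/-- **The inverse `τ = y⁻¹` on the window.** [folklore] -/
def τ : ℝ → ℝ := invFunOn D.y (Icc (D.θ₀ - D.w) (D.θ₀ + D.w))

/-- `τ (y θ) = θ` on the window. [folklore] -/
theorem τ_y {θ : ℝ} (hθ : θ ∈ Icc (D.θ₀ - D.w) (D.θ₀ + D.w)) : D.τ (D.y θ) = θ :=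
  (MonoInverse D.lo_lt_hi D.continuous_y.continuousOn D.strictMonoOn_y).1 θ hθ

/-- `y (τ s) = s` and `τ s` lies in the window, for `s ∈ [ylo, yhi]`. [folklore] -/
theorem y_τ {s : ℝ} (hs : s ∈ Icc D.ylo D.yhi) :
    D.y (D.τ s) = s ∧ D.τ s ∈ Icc (D.θ₀ - D.w) (D.θ₀ + D.w) :=
  (MonoInverse D.lo_lt_hi D.continuous_y.continuousOn D.strictMonoOn_y).2.1 s hs

/-- `τ` is strictly increasing on `[ylo, yhi]`. [folklore] -/
theorem strictMonoOn_τ : StrictMonoOn D.τ (Icc D.ylo D.yhi) :=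
  (MonoInverse D.lo_lt_hi D.continuous_y.continuousOn D.strictMonoOn_y).2.2

/-- `τ 0 = θ₀`. [folklore] -/
theorem τ_zero : D.τ 0 = D.θ₀ := by
  rw [← D.y_θ₀]
  exact D.τ_y ⟨by linarith [D.w_pos], by linarith [D.w_pos]⟩

/-- `τ ylo = θ₀ - w`. [folklore] -/
theorem τ_ylo : D.τ D.ylo = D.θ₀ - D.w := D.τ_y ⟨le_rfl, D.lo_lt_hi.le⟩

/-- `τ yhi = θ₀ + w`. [folklore] -/
theorem τ_yhi : D.τ D.yhi = D.θ₀ + D.w := D.τ_y ⟨D.lo_lt_hi.le, le_rfl⟩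

/-- `τ` maps the open image interval into the open window. [folklore] -/
theorem τ_mem_Ioo {s : ℝ} (hs : s ∈ Ioo D.ylo D.yhi) : D.τ s ∈ Ioo (D.θ₀ - D.w) (D.θ₀ + D.w) := by
  constructor
  · rw [← D.τ_ylo]
    exact D.strictMonoOn_τ ⟨le_rfl, (D.ylo_neg.trans D.yhi_pos).le⟩ ⟨hs.1.le, hs.2.le⟩ hs.1
  · rw [← D.τ_yhi]
    exact D.strictMonoOn_τ ⟨hs.1.le, hs.2.le⟩ ⟨(D.ylo_neg.trans D.yhi_pos).le, le_rfl⟩ hs.2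

/-- **`τ` is smooth with positive derivative on the open image interval.** [folklore] -/
theorem contDiffAt_τ {s : ℝ} (hs : s ∈ Ioo D.ylo D.yhi) :
    ContDiffAt ℝ ∞ D.τ s ∧ deriv D.τ s = (deriv D.y (D.τ s))⁻¹ := by
  have h := MonoInverse_smooth D.lo_lt_hi D.continuous_y.continuousOn D.strictMonoOn_y
    (fun u _ ↦ D.contDiff_y.contDiffAt) (fun u hu ↦ D.deriv_y_pos_of_mem (Ioo_subset_Icc_self hu))
    (D.τ s) (D.τ_mem_Ioo hs)
  rw [(D.y_τ (Ioo_subset_Icc_self hs)).1] at h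
  exact h

/-- `τ' > 0` on the open image interval. [folklore] -/
theorem deriv_τ_pos {s : ℝ} (hs : s ∈ Ioo D.ylo D.yhi) : 0 < deriv D.τ s := by
  rw [(D.contDiffAt_τ hs).2]
  exact inv_pos.2 (D.deriv_y_pos_of_mem (Ioo_subset_Icc_self (D.τ_mem_Ioo hs)))

/-- `τ` is differentiable on the open image interval. [folklore] -/
theorem hasDerivAt_τ {s : ℝ} (hs : s ∈ Ioo D.ylo D.yhi) : HasDerivAt D.τ (deriv D.τ s) s :=
  ((D.contDiffAt_τ hs).1.differentiableAt (by simp)).hasDerivAt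

/-- **The arc parametrised by the second planar coordinate**: `α s = c (τ s)`. [folklore] -/
def α (s : ℝ) : (ℝ × ℝ) × ℝ := D.c (D.τ s)

/-- The arc has second planar coordinate `s`. [folklore] -/
theorem α_fst_snd {s : ℝ} (hs : s ∈ Icc D.ylo D.yhi) : (D.α s).1.2 = s := (D.y_τ hs).1

/-- `α 0 = c θ₀`. [folklore] -/
theorem α_zero : D.α 0 = D.c D.θ₀ := by rw [α, τ_zero]

/-- The planar part of `α 0` is `(-1, 0)`. [folklore] -/
theorem α_zero_fst : (D.α 0).1 = (-1, 0) := by rw [α_zero]; exact D.c_θ₀_fst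

/-- **The graph description of the curve on the window**: `c θ = α (y θ)`. [folklore] -/
theorem c_eq_α_y {θ : ℝ} (hθ : θ ∈ Icc (D.θ₀ - D.w) (D.θ₀ + D.w)) : D.c θ = D.α (D.y θ) := by
  rw [α, D.τ_y hθ]

/-- `y` maps the window into `[ylo, yhi]`. [folklore] -/
theorem y_mem {θ : ℝ} (hθ : θ ∈ Icc (D.θ₀ - D.w) (D.θ₀ + D.w)) : D.y θ ∈ Icc D.ylo D.yhi :=
  ⟨D.strictMonoOn_y.monotoneOn ⟨le_rfl, D.lo_lt_hi.le⟩ hθ hθ.1,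
    D.strictMonoOn_y.monotoneOn hθ ⟨D.lo_lt_hi.le, le_rfl⟩ hθ.2⟩

/-- The arc is smooth on the open image interval. [folklore] -/
theorem contDiffAt_α {s : ℝ} (hs : s ∈ Ioo D.ylo D.yhi) : ContDiffAt ℝ ∞ D.α s :=
  D.contDiff.contDiffAt.comp s (D.contDiffAt_τ hs).1

/-- The chain rule for the arc. [folklore] -/
theorem hasDerivAt_α {s : ℝ} (hs : s ∈ Ioo D.ylo D.yhi) :
    HasDerivAt D.α (deriv D.τ s • deriv D.c (D.τ s)) s :=
  (D.differentiable_c _).hasDerivAt.scomp s (D.hasDerivAt_τ hs)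

/-- The first planar coordinate `g` along the arc. [folklore] -/
def g (s : ℝ) : ℝ := (D.α s).1.1

/-- The height `k` along the arc. [folklore] -/
def k (s : ℝ) : ℝ := (D.α s).2

/-- `g ≤ -1`. [folklore] -/
theorem g_le (s : ℝ) : D.g s ≤ -1 := D.fst_le _

/-- `g 0 = -1`. [folklore] -/
theorem g_zero : D.g 0 = -1 := by
  have := D.α_zero_fst; unfold g; rw [this]

/-- The arc in coordinates. [folklore] -/
theorem α_eq {s : ℝ} (hs : s ∈ Icc D.ylo D.yhi) : D.α s = ((D.g s, s), D.k s) := by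
  have := D.α_fst_snd hs
  ext <;> simp [g, k, this]

/-- `g` is continuous at points of the open image interval. [folklore] -/
theorem continuousAt_g {s : ℝ} (hs : s ∈ Ioo D.ylo D.yhi) : ContinuousAt D.g s :=
  (continuous_fst.comp continuous_fst).continuousAt.comp (D.contDiffAt_α hs).continuousAt

/-- `k` is continuous at points of the open image interval. [folklore] -/
theorem continuousAt_k {s : ℝ} (hs : s ∈ Ioo D.ylo D.yhi) : ContinuousAt D.k s :=
  continuous_snd.continuousAt.comp (D.contDiffAt_α hs).continuousAt

/-! ### The radius `ζ` -/

/-- **The radius `ζ`**: `[-2ζ, 2ζ]` lies inside the open image interval `(ylo, yhi)`. [folklore] -/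
def ζ : ℝ := min (-D.ylo) D.yhi / 4

/-- `ζ > 0`. [folklore] -/
theorem ζ_pos : 0 < D.ζ := by
  unfold ζ
  have := lt_min (neg_pos.2 D.ylo_neg) D.yhi_pos
  linarith

/-- `[-2ζ, 2ζ] ⊆ (ylo, yhi)`. [folklore] -/
theorem Icc_two_ζ_subset : Icc (-(2 * D.ζ)) (2 * D.ζ) ⊆ Ioo D.ylo D.yhi := fun s hs ↦ by
  unfold ζ at hs
  have h1 := min_le_left (-D.ylo) D.yhi
  have h2 := min_le_right (-D.ylo) D.yhi
  have h3 := lt_min (neg_pos.2 D.ylo_neg) D.yhi_pos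
  constructor <;> [linarith [hs.1]; linarith [hs.2]]

/-- `[-ζ, ζ] ⊆ (ylo, yhi)`. [folklore] -/
theorem Icc_ζ_subset : Icc (-D.ζ) D.ζ ⊆ Ioo D.ylo D.yhi := fun s hs ↦
  D.Icc_two_ζ_subset ⟨by linarith [hs.1, D.ζ_pos], by linarith [hs.2, D.ζ_pos]⟩

/-- Points with `|s| ≤ 2ζ` are in the open image interval. [folklore] -/
theorem mem_Ioo_of_abs_le {s : ℝ} (hs : |s| ≤ 2 * D.ζ) : s ∈ Ioo D.ylo D.yhi :=
  D.Icc_two_ζ_subset (abs_le.1 hs)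

/-- Points with `|s| < 2ζ` are in the open image interval. [folklore] -/
theorem mem_Ioo_of_abs_lt {s : ℝ} (hs : |s| < 2 * D.ζ) : s ∈ Ioo D.ylo D.yhi :=
  D.mem_Ioo_of_abs_le hs.le

/-! ### Reduction modulo the period -/

/-- Reduction of a parameter into the fundamental domain `[θ₀ - w, θ₀ - w + 2π)`. [folklore] -/
theorem exists_reduce (θ : ℝ) :
    ∃ (k : ℤ) (θ' : ℝ), θ = θ' + k * (2 * π) ∧ θ' ∈ Ico (D.θ₀ - D.w) (D.θ₀ - D.w + 2 * π) := by
  have hp : (0 : ℝ) < 2 * π := by positivity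
  refine ⟨toIcoDiv hp (D.θ₀ - D.w) θ, toIcoMod hp (D.θ₀ - D.w) θ, ?_, toIcoMod_mem_Ico hp _ _⟩
  have h := self_sub_toIcoDiv_zsmul hp (D.θ₀ - D.w) θ
  rw [zsmul_eq_mul] at h
  linarith

/-- The curve at a reduced parameter. [folklore] -/
theorem c_add_int_mul (θ : ℝ) (k : ℤ) : D.c (θ + k * (2 * π)) = D.c θ :=
  D.periodic.int_mul k θ

/-! ### Separation in space -/

/-- A parameter of the far part and a parameter of the inner window never differ by a multiple of
the period. [folklore] -/
theorem far_ne_near {θ u : ℝ} (hθ : θ ∈ Icc (D.θ₀ + D.w) (D.θ₀ - D.w + 2 * π))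
    (hu : u ∈ Ioo (D.θ₀ - D.w) (D.θ₀ + D.w)) (k : ℤ) : θ ≠ u + k * (2 * π) := by
  intro h
  have hπ : (0 : ℝ) < 2 * π := by positivity
  -- `0 < θ - u < 2π`
  have h1 : (0 : ℝ) < k * (2 * π) := by nlinarith [hθ.1, hu.2]
  have h2 : (k : ℝ) * (2 * π) < 2 * π := by nlinarith [hθ.2, hu.1]
  have hk1 : (0 : ℝ) < k := by
    by_contra hle; push Not at hle; nlinarith
  have hk2 : (k : ℝ) < 1 := by
    by_contra hle; push Not at hle; nlinarith
  have : (0 : ℤ) < k := by exact_mod_cast hk1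
  have : k < 1 := by exact_mod_cast hk2
  omega

/-- **Separation in space**: the far part of the curve keeps a positive distance from the arc
`α [-ζ, ζ]` (compactness; the curve is injective modulo the period). [folklore] -/
theorem exists_sep : ∃ sep : ℝ, 0 < sep ∧ ∀ θ ∈ Icc (D.θ₀ + D.w) (D.θ₀ - D.w + 2 * π),
    ∀ s ∈ Icc (-D.ζ) D.ζ, sep ≤ dist (D.c θ) (D.α s) := by
  set K := Icc (D.θ₀ + D.w) (D.θ₀ - D.w + 2 * π) ×ˢ Icc (-D.ζ) D.ζ with hK
  have hKc : IsCompact K := isCompact_Icc.prod isCompact_Icc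
  have hw := D.w_lt
  have hKne : K.Nonempty := ⟨(D.θ₀ + D.w, 0), ⟨le_rfl, by linarith [Real.pi_pos]⟩,
    ⟨by linarith [D.ζ_pos], D.ζ_pos.le⟩⟩
  set f : ℝ × ℝ → ℝ := fun p ↦ dist (D.c p.1) (D.α p.2) with hf
  have h1 : ContinuousOn (fun p : ℝ × ℝ ↦ D.c p.1) K := D.continuous_c.comp_continuousOn continuousOn_fst
  have h2 : ContinuousOn (fun p : ℝ × ℝ ↦ D.α p.2) K :=
    continuousOn_of_forall_continuousAt fun p hp ↦
      (D.contDiffAt_α (D.Icc_ζ_subset hp.2)).continuousAt.comp continuousAt_snd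
  have hfc : ContinuousOn f K := continuous_dist.comp_continuousOn (h1.prodMk h2)
  obtain ⟨p, hp, hmin⟩ := hKc.exists_isMinOn hKne hfc
  have hpos : 0 < f p := by
    rw [hf]
    refine dist_pos.2 fun heq ↦ ?_
    -- `c θ = c (τ s)` forces `θ ≡ τ s`, impossible for a far `θ`
    obtain ⟨k, hk⟩ := D.eq_imp _ _ heq.symm
    exact D.far_ne_near hp.1 (D.τ_mem_Ioo (D.Icc_ζ_subset hp.2)) k hk
  exact ⟨f p, hpos, fun θ hθ s hs ↦ hmin (show (θ, s) ∈ K from ⟨hθ, hs⟩)⟩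

/-- The separation constant in space. [folklore] -/
def sep : ℝ := Classical.choose D.exists_sep

/-- `sep > 0`. [folklore] -/
theorem sep_pos : 0 < D.sep := (Classical.choose_spec D.exists_sep).1

/-- The far part of the curve is `sep`-far from the arc. [folklore] -/
theorem sep_le {θ : ℝ} (hθ : θ ∈ Icc (D.θ₀ + D.w) (D.θ₀ - D.w + 2 * π)) {s : ℝ} (hs : s ∈ Icc (-D.ζ) D.ζ) :
    D.sep ≤ dist (D.c θ) (D.α s) :=
  (Classical.choose_spec D.exists_sep).2 θ hθ s hs

/-- **Recognition in space.** A point `c θ` of the curve at distance `< sep` from the arc point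
`α s` (`|s| ≤ ζ`) and with second planar coordinate `s` is `α s`. [folklore] -/
theorem eq_α_of_dist_lt {θ s : ℝ} (hs : s ∈ Icc (-D.ζ) D.ζ) (hd : dist (D.c θ) (D.α s) < D.sep)
    (hy : (D.c θ).1.2 = s) : D.c θ = D.α s := by
  obtain ⟨k, θ', rfl, hθ'⟩ := D.exists_reduce θ
  rw [D.c_add_int_mul] at hd hy ⊢
  rcases le_or_gt (D.θ₀ + D.w) θ' with h | h
  · exact absurd (D.sep_le ⟨h, hθ'.2.le⟩ hs) (not_le.2 hd)
  · -- near: the graph description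
    have hmem : θ' ∈ Icc (D.θ₀ - D.w) (D.θ₀ + D.w) := ⟨hθ'.1, h.le⟩
    rw [D.c_eq_α_y hmem]
    unfold y
    rw [hy]

/-! ### Separation in the plane -/

/-- **Separation in the plane**: the plane curve of the far part keeps a positive distance from the
planar arc (compactness; no crossing passage near `θ₀`). [folklore] -/
theorem exists_sepP : ∃ μ : ℝ, 0 < μ ∧ ∀ θ ∈ Icc (D.θ₀ + D.w) (D.θ₀ - D.w + 2 * π),
    ∀ s ∈ Icc (-D.ζ) D.ζ, μ ≤ dist (D.c θ).1 (D.α s).1 := by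
  set K := Icc (D.θ₀ + D.w) (D.θ₀ - D.w + 2 * π) ×ˢ Icc (-D.ζ) D.ζ with hK
  have hKc : IsCompact K := isCompact_Icc.prod isCompact_Icc
  have hw := D.w_lt
  have hKne : K.Nonempty := ⟨(D.θ₀ + D.w, 0), ⟨le_rfl, by linarith [Real.pi_pos]⟩,
    ⟨by linarith [D.ζ_pos], D.ζ_pos.le⟩⟩
  set f : ℝ × ℝ → ℝ := fun p ↦ dist (D.c p.1).1 (D.α p.2).1 with hf
  have h1 : ContinuousOn (fun p : ℝ × ℝ ↦ (D.c p.1).1) K :=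
    continuous_fst.comp_continuousOn (D.continuous_c.comp_continuousOn continuousOn_fst)
  have h2 : ContinuousOn (fun p : ℝ × ℝ ↦ (D.α p.2).1) K :=
    continuousOn_of_forall_continuousAt fun p hp ↦
      continuous_fst.continuousAt.comp
        ((D.contDiffAt_α (D.Icc_ζ_subset hp.2)).continuousAt.comp continuousAt_snd)
  have hfc : ContinuousOn f K := continuous_dist.comp_continuousOn (h1.prodMk h2)
  obtain ⟨p, hp, hmin⟩ := hKc.exists_isMinOn hKne hfc
  have hpos : 0 < f p := by
    rw [hf]
    refine dist_pos.2 fun heq ↦ ?_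
    have hτ := D.τ_mem_Ioo (D.Icc_ζ_subset hp.2)
    have hτ' : D.τ p.2 ∈ Icc (D.θ₀ - D.w₀) (D.θ₀ + D.w₀) :=
      ⟨by linarith [hτ.1, D.w_le_w₀], by linarith [hτ.2, D.w_le_w₀]⟩
    obtain ⟨k, hk⟩ := D.planar_eq_imp (D.τ p.2) p.1 heq.symm hτ'
    exact D.far_ne_near hp.1 hτ k hk
  exact ⟨f p, hpos, fun θ hθ s hs ↦ hmin (show (θ, s) ∈ K from ⟨hθ, hs⟩)⟩

/-- The separation constant in the plane. [folklore] -/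
def μ : ℝ := Classical.choose D.exists_sepP

/-- `μ > 0`. [folklore] -/
theorem μ_pos : 0 < D.μ := (Classical.choose_spec D.exists_sepP).1

/-- The far plane curve is `μ`-far from the planar arc. [folklore] -/
theorem μ_le {θ : ℝ} (hθ : θ ∈ Icc (D.θ₀ + D.w) (D.θ₀ - D.w + 2 * π)) {s : ℝ} (hs : s ∈ Icc (-D.ζ) D.ζ) :
    D.μ ≤ dist (D.c θ).1 (D.α s).1 :=
  (Classical.choose_spec D.exists_sepP).2 θ hθ s hs

/-- **Recognition in the plane.** A plane point `(c θ).1` at distance `< μ` from `(α s).1`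
(`|s| ≤ ζ`) with second coordinate `s` is `(α s).1`. [folklore] -/
theorem fst_eq_of_dist_lt {θ s : ℝ} (hs : s ∈ Icc (-D.ζ) D.ζ) (hd : dist (D.c θ).1 (D.α s).1 < D.μ)
    (hy : (D.c θ).1.2 = s) : (D.c θ).1 = (D.α s).1 := by
  obtain ⟨k, θ', rfl, hθ'⟩ := D.exists_reduce θ
  rw [D.c_add_int_mul] at hd hy ⊢
  rcases le_or_gt (D.θ₀ + D.w) θ' with h | h
  · exact absurd (D.μ_le ⟨h, hθ'.2.le⟩ hs) (not_le.2 hd)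
  · have hmem : θ' ∈ Icc (D.θ₀ - D.w) (D.θ₀ + D.w) := ⟨hθ'.1, h.le⟩
    rw [D.c_eq_α_y hmem]
    unfold y
    rw [hy]

/-- The first planar coordinate of a plane point of the curve with second coordinate `s`, `|s| ≤ ζ`,
within `μ` of the arc is `g s`. [folklore] -/
theorem fst_fst_eq_g_of_lt {θ s : ℝ} (hs : s ∈ Icc (-D.ζ) D.ζ) (hy : (D.c θ).1.2 = s)
    (hd : |(D.c θ).1.1 - D.g s| < D.μ) : (D.c θ).1.1 = D.g s := by
  have hα : (D.α s).1 = (D.g s, s) := by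
    have := D.α_eq (Ioo_subset_Icc_self (D.Icc_ζ_subset hs))
    rw [this]
  have hc : (D.c θ).1 = ((D.c θ).1.1, s) := by rw [← hy]
  have hd' : dist (D.c θ).1 (D.α s).1 < D.μ := by
    rw [hc, hα, Prod.dist_eq, dist_self, Real.dist_eq]
    simpa using hd
  have := D.fst_eq_of_dist_lt hs hd' hy
  rw [hα] at this
  exact (Prod.ext_iff.1 this).1

/-! ### Sizes at the attaching point -/

/-- **`g` is close to `-1` near `0`**: for every `ε > 0` there is `ζ' ∈ (0, ζ]` with
`|g s + 1| < ε` for `|s| ≤ ζ'`. [folklore] -/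
theorem exists_abs_g_add_one_lt {ε : ℝ} (hε : 0 < ε) :
    ∃ ζ' : ℝ, 0 < ζ' ∧ ζ' ≤ D.ζ ∧ ∀ s, |s| ≤ ζ' → |D.g s + 1| < ε := by
  have h0 : (0 : ℝ) ∈ Ioo D.ylo D.yhi := ⟨D.ylo_neg, D.yhi_pos⟩
  have hc := D.continuousAt_g h0
  rw [Metric.continuousAt_iff] at hc
  obtain ⟨δ, hδ, hball⟩ := hc ε hε
  refine ⟨min (δ / 2) D.ζ, lt_min (by linarith) D.ζ_pos, min_le_right _ _, fun s hs ↦ ?_⟩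
  have hsδ : dist s 0 < δ := by
    rw [Real.dist_eq, sub_zero]
    exact hs.trans_lt ((min_le_left _ _).trans_lt (by linarith))
  have := hball hsδ
  rw [Real.dist_eq, D.g_zero, sub_neg_eq_add] at this
  exact this

/-- **`k` is close to `k 0` near `0`.** [folklore] -/
theorem exists_abs_k_sub_lt {ε : ℝ} (hε : 0 < ε) :
    ∃ ζ' : ℝ, 0 < ζ' ∧ ζ' ≤ D.ζ ∧ ∀ s, |s| ≤ ζ' → |D.k s - D.k 0| < ε := by
  have h0 : (0 : ℝ) ∈ Ioo D.ylo D.yhi := ⟨D.ylo_neg, D.yhi_pos⟩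
  have hc := D.continuousAt_k h0
  rw [Metric.continuousAt_iff] at hc
  obtain ⟨δ, hδ, hball⟩ := hc ε hε
  refine ⟨min (δ / 2) D.ζ, lt_min (by linarith) D.ζ_pos, min_le_right _ _, fun s hs ↦ ?_⟩
  have hsδ : dist s 0 < δ := by
    rw [Real.dist_eq, sub_zero]
    exact hs.trans_lt ((min_le_left _ _).trans_lt (by linarith))
  have := hball hsδ
  rw [Real.dist_eq] at this
  exact this

/-- **`g` and `k` are bounded on `[-ζ, ζ]`** (continuity on a compact interval). [folklore] -/
theorem exists_bound : ∃ M : ℝ, 0 < M ∧ ∀ s ∈ Icc (-D.ζ) D.ζ, |D.g s| ≤ M ∧ |D.k s| ≤ M := by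
  have hcont : ContinuousOn D.α (Icc (-D.ζ) D.ζ) :=
    continuousOn_of_forall_continuousAt fun s hs ↦ (D.contDiffAt_α (D.Icc_ζ_subset hs)).continuousAt
  obtain ⟨M, hM⟩ := isCompact_Icc.exists_bound_of_continuousOn hcont
  refine ⟨max M 1, lt_max_of_lt_right one_pos, fun s hs ↦ ?_⟩
  have h := hM s hs
  have h1 : |D.g s| ≤ ‖D.α s‖ := by
    unfold g
    calc |(D.α s).1.1| = ‖(D.α s).1.1‖ := (Real.norm_eq_abs _).symm
      _ ≤ ‖(D.α s).1‖ := norm_fst_le _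
      _ ≤ ‖D.α s‖ := norm_fst_le _
  have h2 : |D.k s| ≤ ‖D.α s‖ := by
    unfold k
    calc |(D.α s).2| = ‖(D.α s).2‖ := (Real.norm_eq_abs _).symm
      _ ≤ ‖D.α s‖ := norm_snd_le _
  exact ⟨h1.trans (h.trans (le_max_left _ _)), h2.trans (h.trans (le_max_left _ _))⟩

end ArcData

end ConnSum

end Literature.Topology.FourManifolds
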